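import Literature.Computability.AlgebraicComplexity.NewtonPolygonTau
import HarnessLib

/-!
# First rungs of the weak Newton-polygon τ-conjecture (KPTT 2015, §5 open problems)

`KPTT.newtonTauWeak` is the in-tree sufficient condition for `VP ≠ VNP` (`KPTT.theorem1_holds`).
Koiran–Portier–Tavenas–Thomassé (arXiv:1308.2286, §5 "Final Remarks") single out its two simplest
open instances; this file types them as precise statements and proves that the second is indeed a
consequence of the weak conjecture (so it is a genuine rung: refuting it refutes the line, proving
it is the first step up).

* `FgPlusOneLinear` — "what is the maximum number of edges of `Newt(fg+1)` for `t`-sparse `f, g`?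
  … the true bound could be linear in `t`" (KPTT §5, problem 1; known `O(t^{4/3})`, KPTT Thm. 5).
  Typed with an unspecified linear constant; the naive guess `2t + 1` (the cancellation-free
  maximum) is refuted by an explicit `t = 4` example with `10` vertices found by this seat's
  adversarial search (docstring of `FgPlusOneLinear`); `2t + 2` is attained for `4 ≤ t ≤ 7`.
  CONJECTURAL, a `Prop`, not asserted.
* `ProdPlusOneBound` — "#edges of `Newt(f_1 ⋯ f_m + 1)` … could be of the form `2^{O(m)} t^{O(1)}`"
  (KPTT §5, problem 2).
* `prodPlusOneBound_of_newtonTauWeak` — `newtonTauWeak → ProdPlusOneBound` (the `k = 2` instance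
  with the second product constant).

References: Koiran–Portier–Tavenas–Thomassé 2015 (arXiv:1308.2286), §5 and Appendix (Thm. 7).
-/

noncomputable section

open MvPolynomial


namespace Summit.ValiantsHypothesis.ValiantsHypothesis.Theorems

open Literature.Computability.AlgebraicComplexity

/-- CONJECTURAL first rung (KPTT 2015 §5, open problem 1): for `t`-sparse bivariate `f, g` over
`ℂ`, the Newton polygon of `f g + 1` has `O(t)` vertices.  Known: `O(t^{4/3})` (KPTT Thm. 5);
`t + 1` when `supp f = supp g` satisfies KPTT's condition (ii) (App., Thm. 7).  The cancellation-free
maximum is `2t + 1` (`Newt(fg+1) = conv(Newt(fg) ∪ {0})` when the constant term of `fg` is not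
`-1`), but `2t + 1` is NOT the answer: for `t = 4`, `f = 1 + XY + XY⁴ - Y⁷`, `g = -1 + XY - X³Y + X⁷`
give `fg + 1 = Y⁷ - XY⁴ - XY⁸ + X²Y² + X²Y⁵ - X³Y + X³Y⁸ - X⁴Y² - X⁴Y⁵ + X⁷ - X⁷Y⁷ + X⁸Y + X⁸Y⁴`, whose
Newton polygon has the `10 = 2t + 2` vertices `(0,7),(1,4),(2,2),(3,1),(7,0),(8,1),(8,4),(7,7),(3,8),(1,8)`
(solo seat, exact arithmetic, verified twice: the shared monomial `XY` cancels in `fg + 1` and its square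
`X²Y²` becomes an extra inner vertex while `XY` still feeds the outer vertices).  `2t + 2` is attained for
every `4 ≤ t ≤ 7` tested; no example beyond `2t + 2` was found (kernel-checked refutation of the `2t + 1`
form: `not_fgPlusOneTwoTAddOne` in `SoloBlindFgPlusOneWitness.lean`).  A `Prop`; nothing is asserted. -/
@[conjecture] def FgPlusOneLinear : Prop :=
  ∃ c : ℕ, ∀ (t : ℕ) (f g : MvPolynomial (Fin 2) ℂ), f.support.card ≤ t → g.support.card ≤ t →
    newtonVertexCount (f * g + 1) ≤ c * (t + 1)

/-- Second rung (KPTT 2015 §5, open problem 2): the Newton polygon of `f_1 ⋯ f_m + 1`, `f_j`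
`t`-sparse, has at most `2^{O(m)} t^{O(1)}` vertices.  (Recorded with the polynomial `(2t+4)^b`.)
A `Prop`; implied by `KPTT.newtonTauWeak` (`prodPlusOneBound_of_newtonTauWeak`). -/
@[conjecture] def ProdPlusOneBound : Prop :=
  ∃ a b : ℕ, ∀ (m t : ℕ) (f : Fin m → MvPolynomial (Fin 2) ℂ), (∀ j, (f j).support.card ≤ t) →
    newtonVertexCount (∏ j, f j + 1) ≤ 2 ^ (a * m) * (2 * t + 4) ^ b

/-- The constant polynomial `1 ∈ ℂ[X,Y]` has at most one monomial. -/
theorem card_support_one_le : (1 : MvPolynomial (Fin 2) ℂ).support.card ≤ 1 := by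
  rw [← C_1, C_apply]
  exact (Finset.card_le_card support_monomial_subset).trans (by simp)

/-- **`newtonTauWeak` implies the `f_1 ⋯ f_m + 1` rung** (the instance `k = 2` of the weak
conjecture with `f_{0j} = f_j`, `f_{1j} = 1`, sparsity `t + 1`). -/
theorem prodPlusOneBound_of_newtonTauWeak (h : KPTT.newtonTauWeak) : ProdPlusOneBound := by
  obtain ⟨a, b, hab⟩ := h
  refine ⟨a, b, fun m t f hf => ?_⟩
  let F : Fin 2 → Fin m → MvPolynomial (Fin 2) ℂ := fun i j => if i = 0 then f j else 1
  have hFt : ∀ i j, (F i j).support.card ≤ t + 1 := by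
    intro i j
    by_cases hi : i = 0
    · simp only [F, if_pos hi]
      exact (hf j).trans (Nat.le_succ t)
    · simp only [F, if_neg hi]
      exact card_support_one_le.trans (by omega)
  have hsum : (∑ i, ∏ j, F i j) = ∏ j, f j + 1 := by
    rw [Fin.sum_univ_two]
    have h0 : ∀ j, F 0 j = f j := fun j => if_pos rfl
    have h1 : ∀ j, F 1 j = 1 := fun j => if_neg (by decide)
    simp only [h0, h1, Finset.prod_const_one]
  have := hab 2 m (t + 1) F hFt
  rw [hsum] at this
  calc newtonVertexCount (∏ j, f j + 1) ≤ 2 ^ (a * m) * (2 * (t + 1) + 2) ^ b := this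
    _ = 2 ^ (a * m) * (2 * t + 4) ^ b := by ring_nf

end Summit.ValiantsHypothesis.ValiantsHypothesis.Theorems
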